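import Summits.ABC.IUTFork.ForkBPS
import Summits.ABC.IUTFork.ForkLana
import HarnessLib

/-!
# The fork at [IUTchIII] Corollary 3.12, XIV: the `q`- and Θ-pilot BPS; the Scholze–Stix hexagon DERIVED

Record-only file (D-0012) of the abc-iut cell's fork skeleton; TAKES NO SIDE. With LANA's value-group
BPS typed (`ForkBPS.lean`), this file types the two BPSs the report actually forms — the `q`-pilot
value-group BPS (§4.2 (c) p. 26) and the Θ-pilot value-group BPS (§7.1 (a) pp. 37–38, with its scalar
`s := (1² + 2² + ⋯ + (ℓ⋇)²)/ℓ⋇` and the map (7-1)) — over abstract positive local degrees `d v`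
(`deg(q̲_v)` at bad `v`, `deg(p_v)` at good finite `v`, `2π` at archimedean `v`), and DERIVES from these
definitions, rather than positing, the statements about the Scholze–Stix hexagon that all three printed
positions make:

* `thetaLink`/`thetaLink_unique`: `PF(B_Θ) = PF(B_q)` (the functional (7-1) is `s·` the functional (4-3)
  of `B_q`, `s ≠ 0`), so by Lemma 4.1.7 there is an isomorphism `B_Θ ⥲ B_q` of value-group BPSs — and
  exactly one: the value-group portion of "(b) … it gives the isomorphism between the Θ-pilot value-group
  BPS on the domain … and the `q`-pilot value-group BPS on the codomain" (§7.1 (b) p. 38).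
* `hexagon_theta_route`/`hexagon_q_route`: LANA §10.2 p. 47, Table 2 — "`ℝ_{⊚,Θ}` = the Θ-pilot
  value-group BPS viewed as an object abstractly isomorphic to the `q`-pilot value-group BPS …
  `ℝ_{⊚c,q}` = the `q`-pilot value-group BPS; `ℝ_Θ` and `ℝ_q` identical copies of the real line `ℝ` …
  all of the arrows in the diagram are morphisms of pointed vector spaces except for the diagonal arrows
  from the middle row to the bottom row, which are degree maps. The composition `ℝ_{⊚,Θ} → ℝ_Θ` scales
  by a factor of `(1/ℓ⋇)(1² + 2² + ⋯ + (ℓ⋇)²)` while the composition `ℝ_{⊚,q} → ℝ_q` scales by a factor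
  of `1`." Typed: the Θ-side degree map is the descent `C_Θ = (⊕ℝ·Θ_v)/PF ⥲ ℝ` of (7-1); the `q`-side
  degree map is the identity of `C_q = ℝ` (the local pilots ARE degrees); THEOREM: on `C_Θ`,
  (degree map) `= s ·` (degree map ∘ Θ-link); every value-group isomorphism `B_q ⥲ B_q` is the identity.
  Hence (`hexagon_not_commute`, `ℓ⋇ ≥ 2`): the two routes differ on the pilot by the factor
  `s = (ℓ⋇+1)(2ℓ⋇+1)/6 > 1` (`= avgWeightAt sqWeights ℓ⋇` of `ForkDegrees`/`ForkLana`) — "we concur that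
  the diagram in Figure 7 does not commute, and that repairing it would require a rescaling factor that is
  too large" (§10.5 p. 49); Mochizuki: (IUAD) "[this situation] occurs whenever one works within a single
  holomorphic structure/ring theory" (quoted ibid.); Scholze–Stix §2.2 p. 10 "monodromy `j²`".
Sources read on the page (nLab pdf of the report): pp. 26, 29, 37–38, 47–49.
[cite: LANA2026Report, §4.2 (c) p. 26, §7.1 pp. 37–38, §10.2 pp. 47–48, §10.5 p. 49]
Deliberately NOT here: `deg(q̲_v)` from Tate parameters ([IUTchI] Ex. 3.2), the étale-unit portion, the bridge to
`ForkCopies.Model` (sibling `ForkSwitch.lean`), (9-1) (sibling `ForkEta.lean`); any judgement.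
-/

noncomputable section

open Finset Module

namespace Summit.ABC

namespace IUTFork

/-! ## 1. The `q`-pilot and Θ-pilot value-group BPS (§4.2 (c), §7.1 (a)) -/

/-- The numerical input of §4.2 (c)/§7.1 (a): places `V ⊇ V^bad ≠ ∅` (a FINITE type here; in print
`V = V(F_mod)` is infinite and `V^bad_mod` "a non-empty finite subset", Notation 2.2.1/Def. 2.2.2 p. 12 —
harmless, as every statement lives on the finite bad-place sum; referee PASS-5 F1), the positive local degrees
`d v` ("`deg(q̲_v)` (`v ∈ V^bad`); `deg(p_v)` (`v ∈ V^good ∩ V^non`); `2π` (`v ∈ V^arc`)", with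
`deg(a) := [F:ℚ]⁻¹ log #(O_{F_v}/a O_{F_v})`), and `ℓ⋇` (`ℓ ≥ 5`, [IUTchI] Def. 3.1 (c)).
[cite: LANA2026Report, §4.2 (c) p. 26] -/
structure LocalDegrees (V : Type) [Fintype V] (bad : Finset V) where
  /-- local degrees `d v > 0` -/
  d : V → ℝ
  /-- positivity (`log` of a cardinality `> 1`, resp. `2π`) -/
  d_pos : ∀ v, 0 < d v
  /-- `V^bad ≠ ∅` -/
  bad_nonempty : bad.Nonempty
  /-- `ℓ⋇ = (ℓ−1)/2` -/
  lstar : ℕ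
  /-- `ℓ ≥ 5` -/
  two_le_lstar : 2 ≤ lstar

namespace LocalDegrees

variable {V : Type} [Fintype V] {bad : Finset V} (D : LocalDegrees V bad)

/-- LANA's scalar `s := (1² + 2² + ⋯ + (ℓ⋇)²)/ℓ⋇` of (7-1). [cite: LANA2026Report, §7.1 (a) p. 37] -/
def s : ℝ := (∑ j ∈ range D.lstar, ((j : ℝ) + 1) ^ 2) / D.lstar

/-- `s` is the average `avgWeightAt sqWeights ℓ⋇` of the weights `j²` of `ForkDegrees` (LANA §10.2 p. 47:
the hexagon scalar). [cite: LANA2026Report, §10.2 p. 47] -/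
theorem s_eq_avgWeightAt : D.s = avgWeightAt sqWeights D.lstar := by
  rw [← (lana_hexagon_scalar D.lstar (by have := D.two_le_lstar; omega)).1, s]
  ring

/-- Closed form `s = (ℓ⋇+1)(2ℓ⋇+1)/6` ((E2) of [IUTchIV] Step (i)). [folklore] -/
theorem s_eq_closed : D.s = ((D.lstar : ℝ) + 1) * (2 * D.lstar + 1) / 6 := by
  rw [D.s_eq_avgWeightAt, (lana_hexagon_scalar D.lstar (by have := D.two_le_lstar; omega)).2]

/-- `s > 1` (`ℓ⋇ ≥ 2`). [folklore] -/
theorem one_lt_s : 1 < D.s := by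
  rw [D.s_eq_avgWeightAt]; exact lana_hexagon_scalar_gt_one D.lstar D.two_le_lstar

/-- `s > 0`. [folklore] -/
theorem s_pos : 0 < D.s := lt_trans one_pos D.one_lt_s

/-- **§4.2 (c): the `q`-pilot value-group BPS** — "put `C := ℝ`; for each `v ∈ V`, define the local pilot
`φ_v ∈ C` at `v` by `φ_v = deg(q̲_v)` (`v ∈ V^bad`); `deg(p_v)` (`v ∈ V^good ∩ V^non`); `2π` (`v ∈ V^arc`)".
[cite: LANA2026Report, §4.2 (c) p. 26] -/
def qBPS : ValueGroupBPS V bad where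
  C := ℝ
  rank_one := Module.finrank_self ℝ
  φ := D.d
  φ_ne v := ne_of_gt (D.d_pos v)
  pilot_ne := ne_of_gt (Finset.sum_pos (fun v _ => D.d_pos v) D.bad_nonempty)

/-- The degree functional `a ↦ Σ_v a_v·d_v` on `⊕_v ℝ_v` — (4-3) for `B_q`, valued in `ℝ`. [folklore] -/
def degMap : (V → ℝ) →ₗ[ℝ] ℝ := Fintype.linearCombination ℝ D.d

/-- `degMap a = Σ_v a_v·d_v`. [folklore] -/
theorem degMap_apply (a : V → ℝ) : D.degMap a = ∑ v, a v * D.d v := by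
  simp only [degMap, Fintype.linearCombination_apply, smul_eq_mul]

/-- (4-3) for `B_q` IS the degree functional. [folklore] -/
theorem qBPS_comb (a : V → ℝ) : D.qBPS.comb a = D.degMap a := rfl

/-- `PF(B_q)` is the kernel of the degree functional. [folklore] -/
theorem qBPS_PF : D.qBPS.PF = LinearMap.ker D.degMap := rfl

/-- The `q`-pilot `φ_{C_q} = Σ_{v∈V^bad} deg(q̲_v)` (a positive real; cf. `|log(q)| > 0`). [folklore] -/
theorem qBPS_pilot : D.qBPS.pilot = ∑ v ∈ bad, D.d v := rfl

/-- **The `q`-side degree map `ℝ_{⊚c,q} → ℝ_q`** (Table 2: "degree maps"): the identity of `C_q = ℝ` — the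
local pilots of `B_q` ARE the degrees `deg(q̲_v)`, `deg(p_v)`, `2π`. [cite: LANA2026Report, §10.2 Table 2 p. 47] -/
def qDeg : D.qBPS.C ≃ₗ[ℝ] ℝ := LinearEquiv.refl ℝ ℝ

/-- `qDeg` is the identity. [folklore] -/
theorem qDeg_apply (x : ℝ) : D.qDeg x = x := rfl

/-- **§7.1 (a): the functional (7-1), at a scale `c`** — `Σ_v ψ_v : ⊕_v ℝ·Θ_v ↠ ℝ` with
`ψ_v(Θ_v) = c·d_v`; LANA's Θ-pilot BPS is `c = s`, its "`j`th-component" (Table 2 p. 47; the component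
`q̲_v^{j²}` of the LGP element, §5.2 (f) p. 29) is `c = j²`. [cite: LANA2026Report, §7.1 (a) (7-1) p. 37] -/
def psi (c : ℝ) : (V → ℝ) →ₗ[ℝ] ℝ := c • D.degMap

/-- (7-1) evaluated. [folklore] -/
theorem psi_apply (c : ℝ) (a : V → ℝ) : D.psi c a = c * ∑ v, a v * D.d v := by
  rw [psi, LinearMap.smul_apply, degMap_apply, smul_eq_mul]

/-- (7-1) on `Θ_v`: `ψ_v(r·Θ_v) = c·r·d_v`. [folklore] -/
theorem psi_single [DecidableEq V] (c : ℝ) (v : V) (r : ℝ) : D.psi c (Pi.single v r) = c * (r * D.d v) := by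
  rw [psi, LinearMap.smul_apply, degMap, Fintype.linearCombination_apply_single, smul_eq_mul, smul_eq_mul]

/-- "write PF for the kernel of the (necessarily surjective) `ℝ`-linear homomorphism (7-1)" — and this
kernel IS the product formula of the `q`-pilot BPS (`c ≠ 0`). [cite: LANA2026Report, §7.1 (a) p. 37] -/
theorem ker_psi {c : ℝ} (hc : 0 < c) : LinearMap.ker (D.psi c) = D.qBPS.PF := by
  rw [psi, LinearMap.ker_smul _ _ (ne_of_gt hc), qBPS_PF]

/-- (7-1) is surjective ("necessarily surjective"). [cite: LANA2026Report, §7.1 (a) p. 37] -/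
theorem psi_surjective {c : ℝ} (hc : 0 < c) : Function.Surjective (D.psi c) := by
  classical
  obtain ⟨v₀, -⟩ := D.bad_nonempty
  intro r
  refine ⟨Pi.single v₀ (r / (c * D.d v₀)), ?_⟩
  rw [psi_single]
  have := D.d_pos v₀
  field_simp

/-- In `(⊕_v ℝ_v)/p`: `Σ_v a_v·[e_v] = [a]`. [folklore] -/
theorem sum_smul_mk_single [DecidableEq V] (p : Submodule ℝ (V → ℝ)) (a : V → ℝ) :
    (∑ v, a v • (Submodule.Quotient.mk (Pi.single v (1 : ℝ)) : (V → ℝ) ⧸ p)) =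
      Submodule.Quotient.mk a := by
  conv_rhs => rw [← Finset.univ_sum_single a]
  rw [← Submodule.mkQ_apply, map_sum]
  refine Finset.sum_congr rfl fun v _ => ?_
  rw [Submodule.mkQ_apply, ← Submodule.Quotient.mk_smul, ← Pi.single_smul', smul_eq_mul, mul_one]

/-- **§7.1 (a): the Θ-pilot value-group BPS (at scale `c`; LANA: `c = s`)** — "write `ℝ_v := ℝ·Θ_v`,
where `Θ_v` is a formal symbol … write PF for the kernel of the (necessarily surjective) `ℝ`-linear
homomorphism … (7-1); write `C := ⊕_{v∈V} ℝ_v / PF`; for each `v ∈ V`, define the local pilot `φ_v ∈ C`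
at `v` to be the image in `C` of `Θ_v ∈ ℝ_v`." [cite: LANA2026Report, §7.1 (a) pp. 37–38] -/
def thetaBPS {c : ℝ} (hc : 0 < c) : ValueGroupBPS V bad where
  C := (V → ℝ) ⧸ LinearMap.ker (D.psi c)
  rank_one := by
    rw [((D.psi c).quotKerEquivOfSurjective (D.psi_surjective hc)).finrank_eq, Module.finrank_self]
  φ v := by classical exact Submodule.Quotient.mk (Pi.single v 1)
  φ_ne v := by
    classical
    rw [Ne, Submodule.Quotient.mk_eq_zero, LinearMap.mem_ker, psi_single, one_mul]
    exact ne_of_gt (mul_pos hc (D.d_pos v))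
  pilot_ne := by
    classical
    rw [show (∑ v ∈ bad, (Submodule.Quotient.mk (Pi.single v (1 : ℝ)) : (V → ℝ) ⧸ LinearMap.ker (D.psi c)))
        = (LinearMap.ker (D.psi c)).mkQ (∑ v ∈ bad, Pi.single v (1 : ℝ)) by rw [map_sum]; rfl,
      Submodule.mkQ_apply, Ne, Submodule.Quotient.mk_eq_zero, LinearMap.mem_ker, map_sum]
    refine ne_of_gt (Finset.sum_pos (fun v _ => ?_) D.bad_nonempty)
    rw [psi_single, one_mul]
    exact mul_pos hc (D.d_pos v)

/-- **The Θ-side degree map `ℝ_{⊚,Θ} → ℝ_Θ`** (Table 2: "degree maps"): the descent of (7-1) to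
`C = (⊕_v ℝ·Θ_v)/PF`, an isomorphism onto `ℝ`. [cite: LANA2026Report, §10.2 Table 2 p. 47] -/
def thetaDeg {c : ℝ} (hc : 0 < c) : (D.thetaBPS hc).C ≃ₗ[ℝ] ℝ :=
  (D.psi c).quotKerEquivOfSurjective (D.psi_surjective hc)

/-- `thetaDeg [a] = ψ(a) = c·Σ_v a_v·d_v`. [folklore] -/
theorem thetaDeg_mk {c : ℝ} (hc : 0 < c) (a : V → ℝ) :
    D.thetaDeg hc (Submodule.Quotient.mk a) = c * ∑ v, a v * D.d v := by
  rw [← psi_apply]; rfl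

/-- (4-3) for `B_Θ`: `Σ_v a_v·φ^Θ_v = [a]`. [folklore] -/
theorem thetaBPS_comb {c : ℝ} (hc : 0 < c) (a : V → ℝ) :
    (D.thetaBPS hc).comb a = Submodule.Quotient.mk a := by
  classical
  rw [ValueGroupBPS.comb_apply]
  exact sum_smul_mk_single _ a

/-- The Θ-side degree of `Σ_v a_v·φ^Θ_v` is `c·Σ_v a_v·d_v`. [folklore] -/
theorem thetaDeg_comb {c : ℝ} (hc : 0 < c) (a : V → ℝ) :
    D.thetaDeg hc ((D.thetaBPS hc).comb a) = c * ∑ v, a v * D.d v := by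
  rw [thetaBPS_comb, thetaDeg_mk]

/-- **`PF(B_Θ) = PF(B_q)`** (any scale `c > 0`): the product formulas agree — Rem. 4.1.5 "The value-group
BPSs that appear in the following discussion all have the same product formula".
[cite: LANA2026Report, Rem. 4.1.5 p. 24, §7.1 (a) p. 37] -/
theorem thetaBPS_PF {c : ℝ} (hc : 0 < c) : (D.thetaBPS hc).PF = D.qBPS.PF := by
  ext a
  rw [ValueGroupBPS.PF, LinearMap.mem_ker, thetaBPS_comb, ← ker_psi D hc]
  show (Submodule.Quotient.mk a : (V → ℝ) ⧸ LinearMap.ker (D.psi c)) = 0 ↔ _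
  rw [Submodule.Quotient.mk_eq_zero]

/-- The value-group BPS obtained from `B_q` by scaling the local pilots at the BAD places only by `c`
(`C = ℝ`, `φ_v = c·d_v` for `v ∈ V^bad`, `φ_v = d_v` otherwise) — the support pattern of the concrete
Θ-pilot divisor `P_{Θ,j} = Σ_{v∈V^bad} ord_v(q̲_v^{j²})[v]` and of the LGP element (`⊗ q̲_v^{j²}` at bad `v`,
`⊗ 1` at good `v`, §5.2 (f) p. 29), as opposed to LANA's Θ-pilot BPS, which scales ALL local pilots by `s`
(`s·deg(p_v)` at good `v`, `s·2π` at archimedean `v`, §7.1 (a) p. 37). [cite: LANA2026Report, §5.2 (f) p. 29] -/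
def badScaledBPS {c : ℝ} (hc : 0 < c) [DecidablePred (· ∈ bad)] : ValueGroupBPS V bad where
  C := ℝ
  rank_one := Module.finrank_self ℝ
  φ v := if v ∈ bad then c * D.d v else D.d v
  φ_ne v := by
    have := D.d_pos v
    split_ifs <;> positivity
  pilot_ne := by
    refine ne_of_gt (Finset.sum_pos (fun v hv => ?_) D.bad_nonempty)
    rw [if_pos hv]; exact mul_pos hc (D.d_pos v)

/-- **Scaling only the bad places changes the product formula** (one good place suffices, `c ≠ 1`): then,
by Lemma 4.1.7, there is NO isomorphism with `B_q` — whereas LANA's uniform `s` at every place keeps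
`PF` fixed (`thetaBPS_PF`; Rem. 4.1.5 "all have the same product formula") and the Θ-link's value-group
isomorphism in existence. So up to isomorphism a value-group BPS cannot record WHICH places carry the
Θ-values: that information lives in the degree maps (the hexagon, §2) — the BPS-level form of Scholze–Stix's
abstract/concrete distinction (`ForkStrips`). [cite: LANA2026Report, Lemma 4.1.7 p. 24, §7.1 (a) p. 37] -/
theorem badScaledBPS_not_iso {c : ℝ} (hc : 0 < c) (hc1 : c ≠ 1) [DecidablePred (· ∈ bad)] {w : V}
    (hw : w ∉ bad) : IsEmpty (ValueGroupBPS.Iso (D.badScaledBPS hc) D.qBPS) := by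
  classical
  obtain ⟨v₀, hv₀⟩ := D.bad_nonempty
  refine ⟨fun Φ => ?_⟩
  have hPF := ValueGroupBPS.PF_eq_of_iso Φ
  -- the divisor `d_w·[v₀] − d_{v₀}·[w]` has degree `0` for `B_q` but not for the bad-scaled BPS
  let a : V → ℝ := Pi.single v₀ (D.d w) - Pi.single w (D.d v₀)
  have hq : a ∈ D.qBPS.PF := by
    rw [ValueGroupBPS.PF, LinearMap.mem_ker, map_sub, ValueGroupBPS.comb_single, ValueGroupBPS.comb_single]
    show D.d w * D.d v₀ - D.d v₀ * D.d w = 0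
    ring
  rw [← hPF, ValueGroupBPS.PF, LinearMap.mem_ker, map_sub, ValueGroupBPS.comb_single,
    ValueGroupBPS.comb_single] at hq
  have hq' : D.d w * (c * D.d v₀) - D.d v₀ * D.d w = 0 := by
    have e1 : (D.badScaledBPS hc).φ v₀ = c * D.d v₀ := if_pos hv₀
    have e2 : (D.badScaledBPS hc).φ w = D.d w := if_neg hw
    rw [e1, e2] at hq
    exact hq
  have : (c - 1) * (D.d v₀ * D.d w) = 0 := by linarith
  rcases mul_eq_zero.mp this with h | h
  · exact hc1 (by linarith)
  · exact (ne_of_gt (mul_pos (D.d_pos v₀) (D.d_pos w))) h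

/-! ## 2. The Θ-link's value-group portion and the hexagon (§7.1 (b), §10.2) -/

/-- **§7.1 (b) (b): the value-group portion of the Θ-link** — "it gives the isomorphism between the Θ-pilot
value-group BPS on the domain Hodge theater `†HT` and the `q`-pilot value-group BPS on the codomain Hodge
theater `‡HT`": it exists by Lemma 4.1.7 (`thetaBPS_PF`). [cite: LANA2026Report, §7.1 (b) p. 38] -/
def thetaLink {c : ℝ} (hc : 0 < c) : ValueGroupBPS.Iso (D.thetaBPS hc) D.qBPS :=
  ValueGroupBPS.isoOfPFEq (D.thetaBPS_PF hc)

/-- … and it is UNIQUE: at the value-group level the "full poly-isomorphism" is one isomorphism.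
[cite: LANA2026Report, §7.1 (b) p. 38] -/
theorem thetaLink_unique {c : ℝ} (hc : 0 < c) (Φ : ValueGroupBPS.Iso (D.thetaBPS hc) D.qBPS) :
    Φ = D.thetaLink hc :=
  (ValueGroupBPS.iso_subsingleton _ _).elim _ _

/-- **The hexagon, Θ-route** (Table 2 + "The composition `ℝ_{⊚,Θ} → ℝ_Θ` scales by a factor of
`(1/ℓ⋇)(1² + ⋯ + (ℓ⋇)²)`"): on `C_Θ`, (Θ-side degree map) `= c ·` (`q`-side degree map ∘ Θ-link), the
`q`-side degree map being the identity of `C_q = ℝ`. DERIVED from Def. 4.1.3/4.1.4, §4.2 (c), §7.1 (a).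
[cite: LANA2026Report, §10.2 p. 47] -/
theorem hexagon_theta_route {c : ℝ} (hc : 0 < c) (x : (D.thetaBPS hc).C) :
    D.thetaDeg hc x = c * D.qDeg ((D.thetaLink hc).toEquiv x) := by
  obtain ⟨a, rfl⟩ := (D.thetaBPS hc).comb_surjective x
  rw [thetaDeg_comb, ValueGroupBPS.Iso.apply_comb, qBPS_comb, degMap_apply]
  rfl

/-- **The hexagon, `q`-route** ("while the composition `ℝ_{⊚,q} → ℝ_q` scales by a factor of `1`"): every
isomorphism of value-group BPSs `B_q ⥲ B_q` ("the `q`-pilot value-group BPS viewed as an object abstractly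
isomorphic to the `q`-pilot value-group BPS" → "the `q`-pilot value-group BPS") is the identity of `ℝ`.
[cite: LANA2026Report, §10.2 p. 47] -/
theorem hexagon_q_route (Φ : ValueGroupBPS.Iso D.qBPS D.qBPS) (x : D.qBPS.C) :
    D.qDeg (Φ.toEquiv x) = D.qDeg x := by
  rw [ValueGroupBPS.iso_self_eq_refl _ Φ]; rfl

/-- **"we concur that the diagram in Figure 7 does not commute"** (LANA §10.5 p. 49; Scholze–Stix §2.2
p. 10): on the Θ-pilot the two routes to `ℝ_Θ = ℝ_q` give `s·Σ_{bad} d_v` and `Σ_{bad} d_v`, which differ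
(`s > 1` for `ℓ⋇ ≥ 2`, `Σ_{bad} d_v > 0`); the mismatch factor is `s = (ℓ⋇+1)(2ℓ⋇+1)/6 ≥ ℓ⋇²/3`
(`ForkLana.lana_repair_factor_quadratic`): "repairing it would require a rescaling factor that is too large
to yield a proof of the abc conjecture". [cite: LANA2026Report, §10.5 p. 49] -/
theorem hexagon_not_commute :
    D.thetaDeg D.s_pos (D.thetaBPS D.s_pos).pilot = D.s * ∑ v ∈ bad, D.d v ∧
      D.qDeg ((D.thetaLink D.s_pos).toEquiv (D.thetaBPS D.s_pos).pilot) = ∑ v ∈ bad, D.d v ∧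
      D.thetaDeg D.s_pos (D.thetaBPS D.s_pos).pilot ≠
        D.qDeg ((D.thetaLink D.s_pos).toEquiv (D.thetaBPS D.s_pos).pilot) := by
  have h2 : D.qDeg ((D.thetaLink D.s_pos).toEquiv (D.thetaBPS D.s_pos).pilot) = ∑ v ∈ bad, D.d v := by
    rw [(D.thetaLink D.s_pos).map_pilot, qBPS_pilot]
    rfl
  have h1 : D.thetaDeg D.s_pos (D.thetaBPS D.s_pos).pilot = D.s * ∑ v ∈ bad, D.d v := by
    rw [hexagon_theta_route, h2]
  refine ⟨h1, h2, ?_⟩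
  rw [h1, h2]
  have hq : 0 < ∑ v ∈ bad, D.d v := Finset.sum_pos (fun v _ => D.d_pos v) D.bad_nonempty
  have hs := D.one_lt_s
  intro h
  have : (D.s - 1) * ∑ v ∈ bad, D.d v = 0 := by linarith
  rcases mul_eq_zero.mp this with h' | h' <;> linarith

/-- **Step 1 of the `η`-algorithm, value-group part** (§9.1 (a) p. 44: "Choose an isomorphism between the
given BPS and the Θ-pilot BPS"; §6.2 (b) p. 33: "Since this choice is not canonical, Ind1 and Ind2 arise";
Rem. 6.2.2 pp. 33–34: "the input to the "raw" Theorem 3.11 algorithm appears to consist solely of the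
étale-unit BPS, and the value-group part does not seem to affect the algorithm's result … Reconciling these
points remains a topic of discussion among LANA members"). Typed partial answer: for an input value-group
BPS `B` the choice EXISTS iff `PF(B) = PF(B_q)` and is then UNIQUE — the value-group portion of the input
contributes one constraint and no choice; every choice in Step 1 (hence (Ind1), (Ind2)) is in the
étale-unit portion (`ForkBPS` `BPS.isoEquivUnit`). [cite: LANA2026Report, §9.1 (a) p. 44, Rem. 6.2.2 pp. 33–34] -/
theorem step1_valueGroup {c : ℝ} (hc : 0 < c) (B : ValueGroupBPS V bad) :
    (Nonempty (ValueGroupBPS.Iso B (D.thetaBPS hc)) ↔ B.PF = D.qBPS.PF) ∧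
      Subsingleton (ValueGroupBPS.Iso B (D.thetaBPS hc)) := by
  refine ⟨?_, ValueGroupBPS.iso_subsingleton _ _⟩
  rw [ValueGroupBPS.iso_nonempty_iff, thetaBPS_PF]

/-- LANA's `s` is the procession-normalised AVERAGE of the component scales `j²`, `j = 1, …, ℓ⋇`: the
functional (7-1) of the Θ-pilot BPS is the average of those of its `j`-components (the LGP element has
components `q̲_v^{j²}`, §5.2 (f) p. 29; [IUTchIII] Cor. 3.12 "the average is taken over `j ∈ 𝔽_l^⋇`").
[cite: LANA2026Report, §7.1 (a) p. 37, §5.2 (f) p. 29] -/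
theorem psi_s_eq_avg :
    D.psi D.s = (1 / (D.lstar : ℝ)) • ∑ j ∈ range D.lstar, D.psi (((j : ℝ) + 1) ^ 2) := by
  simp only [psi]
  rw [← Finset.sum_smul, smul_smul]
  congr 1
  rw [s]; ring

end LocalDegrees

end IUTFork

end Summit.ABC

end
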